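import Literature.NumberTheory.Automorphic.LanglandsTunnellModThree
import Literature.NumberTheory.EllipticCurves.CMNewformGamma0OfGrossencharakter
import Literature.NumberTheory.GaloisRepresentations.CliffordInducedPrimeIndexConj
import Literature.NumberTheory.GaloisRepresentations.FramedGaloisRepInduce
import Literature.NumberTheory.GaloisRepresentations.ArtinCharacterReciprocity
import Literature.NumberTheory.GaloisRepresentations.GrossencharakterIdeleValue
import Literature.NumberTheory.GaloisRepresentations.PrimaryGeneratorHeckeCharacter
import HarnessLib

/-!
# STUB-IDEAS `stub_modThree` — ideator k = 2 (gen 2), HOME FAMILY 2 = RESHAPE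

Typing aid for `STUB-IDEAS-stub_modThree-2.md` (crux `FreyModularity`, skeleton `Lines/Sketch.lean`).
Helpers `H1 … H8` are `sorry`-stubs (signatures only, each meant to be ONE prover cycle);
`stub_modThree_of_helpers` is the assembly and has the stub's signature VERBATIM.

RESHAPE: (T1) regime split by the image of `ρ̄` (full `GL₂(𝔽₃)` vs. Cartan-normaliser);
(T2) in the Cartan-normaliser ("dihedral") regime replace the weight-ONE EQUALITY of Langlands–Tunnell
(strong Artin) by a weight-TWO CONGRUENCE with a CM newform, produced by the tree's PROVED `Γ₀` theta
engine `Ribet1977_cmNewform_gamma0_of_isGrossencharakter_holds` (`k = 2`) — `ModPGaloisRep.IsModular`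
allows any weight `w ≥ 1`, and `det ρ̄ = χ̄₃` (from `IsTorsionGaloisRep`) is exactly what makes the
Nebentypus trivial; (T3) the octahedral regime is isolated as the residual (= status quo, all Tunnell leaves).
-/

set_option autoImplicit false
set_option linter.dupNamespace false

noncomputable section

open scoped MatrixGroups NumberField Polynomial ModularForm
open Polynomial NumberField IsDedekindDomain CongruenceSubgroup
open Literature.NumberTheory.GaloisRepresentations Literature.NumberTheory.Automorphic
open Literature.NumberTheory.EllipticCurves.ModularForms Literature.NumberTheory.LFunctions
open Literature.NumberTheory.GaloisRepresentations.GL2F3Lift (lift redHom embHom)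

namespace Summit.ABC.ABC.Cruxes.FreyModularity.Sketch.StubIdeasModThreeK2G2

/-- `𝔣` is the exact conductor of the ideal-theoretic finite-order Größencharakter `χ`:
no strictly larger ideal `𝔣' ⊋ 𝔣` (= proper divisor) is a modulus for any character agreeing with `χ`
off `𝔣`. -/
def IsConductor {M : Type} [Field M] [NumberField M] (𝔣 : Ideal (𝓞 M))
    (χ : HeightOneSpectrum (𝓞 M) → ℂ) : Prop :=
  IsGrossencharakter 𝔣 (fun _ => 0) (fun _ => 0) χ ∧
    ∀ 𝔣' : Ideal (𝓞 M), 𝔣 < 𝔣' → ∀ χ' : HeightOneSpectrum (𝓞 M) → ℂ,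
      (∀ w, ¬ 𝔣 ≤ w.asIdeal → χ' w = χ w) → ¬ IsGrossencharakter 𝔣' (fun _ => 0) (fun _ => 0) χ'

/-! ### H1 (M) — weight-free congruence descent (80 % copy of `…isModular_of_…_langlands_tunnell`,
`LanglandsTunnellModThree.lean` L455–556: `θ : 𝓞_f → ℤ̄`, `ι = (mk 𝔓) ∘ θ`, lifts via `hint/hlifts`;
the equality `key` is replaced by the congruence hypothesis). -/
theorem H1_isModular_of_congruence (ρ : ModPGaloisRep ℚ (ZMod 3) 2)
    (𝔓 : Ideal (integralClosure ℤ ℂ)) [𝔓.IsMaximal]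
    (h𝔓 : RingHom.ker redHom ≤ 𝔓.comap embInt)
    (N : ℕ) [NeZero N] (w : ℤ) (hw : 1 ≤ w) (f : CuspForm (Gamma1 N) w) (hnew : IsNewform1 f)
    (hgal : ∀ v : HeightOneSpectrum (𝓞 ℚ),
      ((Rat.HeightOneSpectrum.primesEquiv v : Nat.Primes) : ℕ) ∉ {q : ℕ | q ∣ N * 3} →
        ρ.IsUnramifiedAt v ∧
        ∃ P : (integralClosure ℤ ℂ)[X],
          P.map (algebraMap (integralClosure ℤ ℂ) ℂ) =
            (heckePolynomial f (Rat.HeightOneSpectrum.primesEquiv v : Nat.Primes)).map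
              (algebraMap (coeffCharField f) ℂ) ∧
          ∀ 𝔔 ∈ v.primesAbove, ∀ τ : Field.absoluteGaloisGroup ℚ, IsArithFrobAt (𝓞 ℚ) τ 𝔔 →
            ((lift (ρ τ)).charpoly.map embInt).map (Ideal.Quotient.mk 𝔓) =
              P.map (Ideal.Quotient.mk 𝔓)) :
    ρ.IsModular := by
  sorry

/-! ### H2 (S) — oddness from the Weil pairing (verbatim tree lines L575–582). -/
theorem H2_isOdd (W : WeierstrassCurve ℚ) [W.IsElliptic] (ρ : ModPGaloisRep ℚ (ZMod 3) 2)
    (hρ : W.IsTorsionGaloisRep 3 ρ) : FramedGaloisRep.IsOdd ρ := by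
  haveI : NeZero ((3 : ℕ) : ℚ) := ⟨by norm_num⟩
  intro φ c hc
  rw [W.det_eq_modPCyclotomicCharacter_of_isTorsionGaloisRep_holds 3 ρ hρ c]
  ext
  rw [modPCyclotomicCharacterZMod_eq_modNCyclotomicCharacter,
    modNCyclotomicCharacter_of_isComplexConjugation hc, Units.val_neg, Units.val_one]

/-! ### H3 (M) — regime split: an odd absolutely irreducible `ρ̄ : Γ_ℚ → GL₂(𝔽₃)` is either
surjective or lands in a Cartan normaliser, whose Cartan cuts out an IMAGINARY quadratic `M` with
`σ|_{Γ_M}` reducible (`σ = modThreeLift ρ̄`; H3a finite group theory in `GL₂(𝔽₃)` — proper absolutely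
irreducible subgroups with `det = ±1` lie in `N(C_s) ≅ D₈` or `N(C_ns) ≅ SD₁₆`, and an index-2 ABELIAN
subgroup avoiding the image of complex conjugation exists; H3b infinite Galois theory: fixed field of
an open index-2 subgroup of `Γ_ℚ`). -/
theorem H3_full_or_dihedral (ρ : ModPGaloisRep ℚ (ZMod 3) 2)
    (habs : FramedRep.IsAbsolutelyIrreducible ρ) (hodd : FramedGaloisRep.IsOdd ρ) :
    MonoidHom.range ρ.toMonoidHom = ⊤ ∨
    ∃ (M : Type) (_ : Field M) (_ : NumberField M) (_ : Algebra ℚ M),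
      IsGalois ℚ M ∧ Module.finrank ℚ M = 2 ∧ IsTotallyComplex M ∧
      ¬ FramedRep.IsIrreducible ((modThreeLift ρ).restrictField M) := by
  sorry

/-! ### H4 (L) — dihedral regime ⇒ ideal-theoretic Hecke data.  Clifford
(`exists_conj_eq_reindex_induce_of_not_isIrreducible_restrictField_of_prime`, `m = 1`) on the char-0
lift `σ`; `artinReciprocity_character_holds` (PROVED) ⇒ finite-order `ω`; `exists_isModulus_of_ramified`
+ `IsFiniteOrder.hasInfinityType_zero` + `HasInfinityType.isGrossencharakter_valueAtUniformizer` ⇒ `χ`;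
`hasFrobCharpolyAt_induce` + conj/reindex-invariance of `charpoly` ⇒ Frobenius polynomials;
`det σ = lift(χ̄₃)` (from `hρ`) ⇒ `χ((n)) = (d_M/n)(-3/n)`; conductor support of `ram(σ)`
(ray class field of `𝔣` + Chebotarev rigidity `FramedGaloisRep.eq_or_eq_of_frobenius`). -/
theorem H4_dihedralHeckeData (W : WeierstrassCurve ℚ) [W.IsElliptic] (ρ : ModPGaloisRep ℚ (ZMod 3) 2)
    (hρ : W.IsTorsionGaloisRep 3 ρ) (habs : FramedRep.IsAbsolutelyIrreducible ρ)
    (M : Type) [Field M] [NumberField M] [Algebra ℚ M] [IsGalois ℚ M] [IsTotallyComplex M]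
    (h2 : Module.finrank ℚ M = 2)
    (hred : ¬ FramedRep.IsIrreducible ((modThreeLift ρ).restrictField M)) :
    ∃ (𝔣 : Ideal (𝓞 M)) (χ : HeightOneSpectrum (𝓞 M) → ℂ), 𝔣 ≠ ⊥ ∧
      IsGrossencharakter 𝔣 (fun _ => 0) (fun _ => 0) χ ∧ IsConductor 𝔣 χ ∧
      (∀ w, ¬ 𝔣 ≤ w.asIdeal → ∃ n : ℕ, 0 < n ∧ χ w ^ n = 1) ∧
      (∀ n : ℕ, Odd n → n.Coprime (3 * (discr M).natAbs * Ideal.absNorm 𝔣) →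
        idealPow M χ (Ideal.span {(n : 𝓞 M)}) = (jacobiSym (discr M) n : ℂ) * jacobiSym (-3) n) ∧
      ∀ v : HeightOneSpectrum (𝓞 ℚ),
        ¬ ((Rat.HeightOneSpectrum.primesEquiv v : Nat.Primes) : ℕ) ∣
            3 * (discr M).natAbs * Ideal.absNorm 𝔣 →
        (modThreeLift ρ).IsUnramifiedAt v ∧
        (modThreeLift ρ).HasFrobCharpolyAt v
          (inducedFrobPolynomial v fun w : HeightOneSpectrum (𝓞 M) => X - C (χ w)) := by
  sorry

/-! ### H5 (M) — the type-`(1,0)` Größencharakter `Ψ₀ mod 3𝓞_M` with `Ψ₀ ≡ 1 (mod 𝔓)`, ANY class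
number: `(α) ↦ σe(α)` on the ray `α ≡ 1 (3)` (no unit `≠ 1` is `≡ 1 mod 3`), extended by divisibility of
`ℂˣ` (`Literature.GroupTheory.Abelian.exists_extension_of_divisible`), then Teichmüller-corrected by a
prime-to-3-order ray class character so that every prime value is `≡ 1 mod 𝔓`; automatically
`Ψ₀((n)) = (-3/n)·n` for odd `n ⊥ 3`. -/
theorem H5_typeOneZero_modThree (M : Type) [Field M] [NumberField M] [Algebra ℚ M]
    [IsTotallyComplex M] (h2 : Module.finrank ℚ M = 2) (σe : M →+* ℂ)
    (𝔓 : Ideal (integralClosure ℤ ℂ)) [𝔓.IsMaximal] (h𝔓 : RingHom.ker redHom ≤ 𝔓.comap embInt) :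
    ∃ Ψ₀ : HeightOneSpectrum (𝓞 M) → ℂ,
      IsGrossencharakter (Ideal.span {(3 : 𝓞 M)})
        (fun w => (((2 : ℕ) : ℤ) - 1) * embType σe w) (fun w => (((2 : ℕ) : ℤ) - 1) * embTypeConj σe w) Ψ₀ ∧
      (∀ w, ¬ Ideal.span {(3 : 𝓞 M)} ≤ w.asIdeal →
        ∃ x : integralClosure ℤ ℂ, (x : ℂ) = Ψ₀ w ∧ x - 1 ∈ 𝔓) ∧
      ∀ n : ℕ, Odd n → n.Coprime 3 →
        idealPow M Ψ₀ (Ideal.span {(n : 𝓞 M)}) = (jacobiSym (-3) n : ℂ) * n := by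
  sorry

/-! ### H6 (M) — the CM newform and the congruence.  `Ψ := χ·Ψ₀` is a Größencharakter mod
`𝔣·3𝓞_M` of type `σe¹` (`IsGrossencharakter.mul`) with `Ψ((n)) = (d_M/n)·n` (from H4's `hdet` and
H5), so the PROVED `Ribet1977_cmNewform_gamma0_of_isGrossencharakter_holds` (`k = 2`) gives a newform
`g ∈ S₂(Γ₀(N))`, `N ∣ D·N(3𝔣)`, `a_p(g) = Σ_{Nv=p} Ψ(v) ≡ Σ χ(v) = tr σ(Frob_p) (mod 𝔓)` and
`p ≡ det σ(Frob_p)`; Hecke polynomial of `liftToGamma1 N 2 g` is `X² - a_p X + p`;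
`IsNewform1` of the lift: `isNewform1_liftToGamma1_iff_holds`; `ρ̄` unramified where `σ` is (`Ψ` injective);
`hρ` (det `ρ̄ = χ̄₃`) is needed for the constant term at `p = 2` (`hdet` only speaks about odd `n`). -/
theorem H6_cmNewformCongruence (W : WeierstrassCurve ℚ) [W.IsElliptic]
    (ρ : ModPGaloisRep ℚ (ZMod 3) 2) (hρ : W.IsTorsionGaloisRep 3 ρ)
    (M : Type) [Field M] [NumberField M] [Algebra ℚ M] [IsTotallyComplex M]
    (h2 : Module.finrank ℚ M = 2)
    (𝔓 : Ideal (integralClosure ℤ ℂ)) [𝔓.IsMaximal] (h𝔓 : RingHom.ker redHom ≤ 𝔓.comap embInt)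
    (𝔣 : Ideal (𝓞 M)) (χ : HeightOneSpectrum (𝓞 M) → ℂ) (h𝔣 : 𝔣 ≠ ⊥)
    (hχ : IsGrossencharakter 𝔣 (fun _ => 0) (fun _ => 0) χ)
    (hfin : ∀ w, ¬ 𝔣 ≤ w.asIdeal → ∃ n : ℕ, 0 < n ∧ χ w ^ n = 1)
    (hdet : ∀ n : ℕ, Odd n → n.Coprime (3 * (discr M).natAbs * Ideal.absNorm 𝔣) →
        idealPow M χ (Ideal.span {(n : 𝓞 M)}) = (jacobiSym (discr M) n : ℂ) * jacobiSym (-3) n)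
    (hfrob : ∀ v : HeightOneSpectrum (𝓞 ℚ),
        ¬ ((Rat.HeightOneSpectrum.primesEquiv v : Nat.Primes) : ℕ) ∣
            3 * (discr M).natAbs * Ideal.absNorm 𝔣 →
        (modThreeLift ρ).IsUnramifiedAt v ∧
        (modThreeLift ρ).HasFrobCharpolyAt v
          (inducedFrobPolynomial v fun w : HeightOneSpectrum (𝓞 M) => X - C (χ w)))
    (σe : M →+* ℂ) (Ψ₀ : HeightOneSpectrum (𝓞 M) → ℂ)
    (hΨ₀ : IsGrossencharakter (Ideal.span {(3 : 𝓞 M)})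
        (fun w => (((2 : ℕ) : ℤ) - 1) * embType σe w) (fun w => (((2 : ℕ) : ℤ) - 1) * embTypeConj σe w) Ψ₀)
    (hcong : ∀ w, ¬ Ideal.span {(3 : 𝓞 M)} ≤ w.asIdeal →
        ∃ x : integralClosure ℤ ℂ, (x : ℂ) = Ψ₀ w ∧ x - 1 ∈ 𝔓)
    (hΨ₀Z : ∀ n : ℕ, Odd n → n.Coprime 3 →
        idealPow M Ψ₀ (Ideal.span {(n : 𝓞 M)}) = (jacobiSym (-3) n : ℂ) * n) :
    ∃ (N : ℕ) (_ : NeZero N) (g : CuspForm (Gamma0 N) 2),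
      N ∣ (discr M).natAbs * Ideal.absNorm (𝔣 * Ideal.span {(3 : 𝓞 M)}) ∧ IsNewform0 g ∧
      IsNewform1 (liftToGamma1 N 2 g) ∧
      (∀ p : ℕ, p.Prime → ¬ p ∣ 3 * (discr M).natAbs * Ideal.absNorm 𝔣 →
        cuspCoeff g p = ∑ᶠ (v : HeightOneSpectrum (𝓞 M)) (_ : Ideal.absNorm v.asIdeal = p), χ v * Ψ₀ v) ∧
      ∀ v : HeightOneSpectrum (𝓞 ℚ),
        ¬ ((Rat.HeightOneSpectrum.primesEquiv v : Nat.Primes) : ℕ) ∣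
            3 * (discr M).natAbs * Ideal.absNorm 𝔣 →
          ρ.IsUnramifiedAt v ∧
          ∃ P : (integralClosure ℤ ℂ)[X],
            P.map (algebraMap (integralClosure ℤ ℂ) ℂ) =
              (heckePolynomial (liftToGamma1 N 2 g)
                  (Rat.HeightOneSpectrum.primesEquiv v : Nat.Primes)).map
                (algebraMap (coeffCharField (liftToGamma1 N 2 g)) ℂ) ∧
            ∀ 𝔔 ∈ v.primesAbove, ∀ τ : Field.absoluteGaloisGroup ℚ, IsArithFrobAt (𝓞 ℚ) τ 𝔔 →
              ((lift (ρ τ)).charpoly.map embInt).map (Ideal.Quotient.mk 𝔓) =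
                P.map (Ideal.Quotient.mk 𝔓) := by
  sorry

/-! ### H7 (L — the ONE new input of the dihedral branch) — level support: a `Γ₀(N)` NEWFORM whose
`a_p` are those of `θ_{χΨ₀}` off `3·D·N𝔣`, with `𝔣` the CONDUCTOR of `χ`, has every prime of `D·N𝔣`
dividing `3N` (exact level `|d_M|·N(𝔣_Ψ)` of a primitive CM newform: Shimura 1971 Lemma 3 / 1972 p. 138,
Ribet 1977 Remark (3.5), Miyake Thm. 4.8.2; + multiplicity one).  Galois-side alternative in the md. -/
theorem H7_levelSupport (M : Type) [Field M] [NumberField M] [Algebra ℚ M] [IsTotallyComplex M]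
    (h2 : Module.finrank ℚ M = 2) (σe : M →+* ℂ)
    (𝔣 : Ideal (𝓞 M)) (χ : HeightOneSpectrum (𝓞 M) → ℂ) (hcond : IsConductor 𝔣 χ)
    (hfin : ∀ w, ¬ 𝔣 ≤ w.asIdeal → ∃ n : ℕ, 0 < n ∧ χ w ^ n = 1)
    (Ψ₀ : HeightOneSpectrum (𝓞 M) → ℂ)
    (hΨ₀ : IsGrossencharakter (Ideal.span {(3 : 𝓞 M)})
        (fun w => (((2 : ℕ) : ℤ) - 1) * embType σe w) (fun w => (((2 : ℕ) : ℤ) - 1) * embTypeConj σe w) Ψ₀)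
    (N : ℕ) [NeZero N] (g : CuspForm (Gamma0 N) 2) (hnew : IsNewform0 g)
    (hcoef : ∀ p : ℕ, p.Prime → ¬ p ∣ 3 * (discr M).natAbs * Ideal.absNorm 𝔣 →
        cuspCoeff g p = ∑ᶠ (v : HeightOneSpectrum (𝓞 M)) (_ : Ideal.absNorm v.asIdeal = p), χ v * Ψ₀ v) :
    ∀ p : ℕ, p.Prime → p ∣ 3 * (discr M).natAbs * Ideal.absNorm 𝔣 → p ∣ N * 3 := by
  sorry

/-! ### H8 (XL, = status quo) — the octahedral residual: for SURJECTIVE `ρ̄`, Langlands–Tunnell at the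
single Artin representation `σ = modThreeLift ρ̄` (|im σ| = 48; Tunnell 1981 via the leaves of
`langlands_tunnell_of_leaves'`, or any other socket: Serre/Khare–Wintenberger).  H8s (S): the existing
descent used POINTWISE (its proof calls `hLT` only at `σ`). -/
theorem H8_octahedral_langlandsTunnell (ρ : ModPGaloisRep ℚ (ZMod 3) 2)
    (hodd : FramedGaloisRep.IsOdd ρ) (hfull : MonoidHom.range ρ.toMonoidHom = ⊤) :
    langlands_tunnell (modThreeLift ρ) := by
  sorry

theorem H8s_isModular_of_langlands_tunnell_at (ρ : ModPGaloisRep ℚ (ZMod 3) 2)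
    (habs : FramedRep.IsAbsolutelyIrreducible ρ) (hodd : FramedGaloisRep.IsOdd ρ)
    (hLTσ : langlands_tunnell (modThreeLift ρ)) : ρ.IsModular := by
  sorry

/-! ### Assembly — the stub's signature VERBATIM. -/
theorem stub_modThree_of_helpers :
    ∀ (W : WeierstrassCurve ℚ) [W.IsElliptic] (ρ : ModPGaloisRep ℚ (ZMod 3) 2),
      W.IsTorsionGaloisRep 3 ρ → FramedRep.IsAbsolutelyIrreducible ρ → ρ.IsModular := by
  intro W _ ρ hρ habs
  have hodd : FramedGaloisRep.IsOdd ρ := H2_isOdd W ρ hρ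
  rcases H3_full_or_dihedral ρ habs hodd with hfull | ⟨M, _, _, _, hgalM, h2, htc, hred⟩
  · exact H8s_isModular_of_langlands_tunnell_at ρ habs hodd
      (H8_octahedral_langlandsTunnell ρ hodd hfull)
  · haveI := hgalM
    haveI := htc
    obtain ⟨𝔓, h𝔓max, h𝔓⟩ := exists_ideal_over_ker_redHom
    haveI : 𝔓.IsMaximal := h𝔓max
    have hle : RingHom.ker redHom ≤ 𝔓.comap embInt := h𝔓.ge
    obtain ⟨𝔣, χ, h𝔣, hχ, hcond, hfin, hdet, hfrob⟩ :=
      H4_dihedralHeckeData W ρ hρ habs M h2 hred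
    obtain ⟨σe⟩ : Nonempty (M →+* ℂ) := inferInstance
    obtain ⟨Ψ₀, hΨ₀, hcong, hΨ₀Z⟩ := H5_typeOneZero_modThree M h2 σe 𝔓 hle
    obtain ⟨N, hN, g, -, hnew0, hnew1, hcoef, hgal⟩ :=
      H6_cmNewformCongruence W ρ hρ M h2 𝔓 hle 𝔣 χ h𝔣 hχ hfin hdet hfrob σe Ψ₀ hΨ₀ hcong hΨ₀Z
    have hsupp := H7_levelSupport M h2 σe 𝔣 χ hcond hfin Ψ₀ hΨ₀ N g hnew0 hcoef
    refine H1_isModular_of_congruence ρ 𝔓 hle N 2 (by norm_num) (liftToGamma1 N 2 g) hnew1 ?_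
    intro v hv
    set p : ℕ := ((Rat.HeightOneSpectrum.primesEquiv v : Nat.Primes) : ℕ) with hp
    have hpp : p.Prime := (Rat.HeightOneSpectrum.primesEquiv v : Nat.Primes).2
    by_cases hbad : p ∣ 3 * (discr M).natAbs * Ideal.absNorm 𝔣
    · exact absurd (hsupp p hpp hbad) hv
    · exact hgal v hbad

end Summit.ABC.ABC.Cruxes.FreyModularity.Sketch.StubIdeasModThreeK2G2

end
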